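import Summits.CriticalPhenomena.PercolationContinuityZ3.Theorems.PercNearOneGluingNoHeavyLowerTailFKHullPortTADefs
import Summits.CriticalPhenomena.PercolationContinuityZ3.Theorems.PercNearOneGluingNoHeavyLowerTailHullPortTASDefs
import HarnessLib

/-!
# FK sub-lane: the owner-set `T^S` functionals for the random-cluster measure `φ_{𝐩,q}` (definitions)

Definitions file (`--supports stmt-CriticalPhenomena-4575`), FK sub-lane `prim-bschramm-fk-2` (gen 3); builds on p205010 (kernel
theorem, internal audit signed; external expert review pending).  No theorems, no named facts, no sorries.

The random-cluster analogues of prim-hp-7's owner-set functionals `HullPort.taCS … taQS` (`…HullPortTASDefs.lean`, product measure;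
HP7-HTW-PROOF.md §0–§1: `T^S ≥ 0` = (Htw) = the (K9)-diagonal of PROOF-S5-ALL-R), in the bookkeeping of this cell's `FK.taC … taQ`
(`…FKHullPortTADefs.lean`, bschramm/FK-Q2.md §12.1, §12.6(c)): configuration weight `rcWeightW w q ∅` (Grimmett (1.20)), world
expectation `FK.wE w q (cut X ω) ·` = the random-cluster measure with the pairs meeting the open vertex cluster of the avoided set `X`
given parameter `0`, same `q` (vdBHK Lemma 2.3).  With an owner `x`, an owner SET `S ∋ x`, an observer `v`, a marker `o`, an avoided
set `X` and `K̄ = cut X ω`: `FK.taCS` (`Cov_{φ_{G−K̄,q}}(g(C_x), 1{v ↔ S})`), `FK.taNS` (`φ_{G−K̄,q}(v ↮ S)`), `FK.taNWS`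
(`φ_{G−K̄,q}(v ↮ S, v ↔ o)`), `FK.taBS = Σ_ω w_q 1_{x↮X} c`, `FK.taAS = Σ_ω w_q 1_{x↮X} (taNWS/taNS) c`, `FK.tabS = Z·φ(v ↮ S ∪ X)`,
`FK.taaS = Z·φ(v ↮ S ∪ X, v ↔ o)`, `FK.taQS = taAS·tabS − taaS·taBS` (`= Z²·b·T^S`).  The connection event `HullPort.connS S v = {v ↔ S}`,
the cut set `HullPort.cut` and the avoidance events `HullPort.avoidEv` are measure-free and reused.  At `S = {x}` these are the
`FK.ta*` functionals with `(s, y, z) = (x, v, o)`.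
[cite: Grimmett2006, §1.4 eq. (1.20) (p. 15)] [cite: VandenbergHaggstromKahn2005, §2.1 Lemma 2.3 (p. 10); §1 pp. 3–5]
-/

noncomputable section

namespace Summit.CriticalPhenomena.PercolationContinuityZ3.Theorems.FK

open MeasureTheory Set Literature.Probability.LatticeModels Literature.Probability.Percolation
open Literature.Probability.Percolation.DecisionTree (ind)
open Literature.Probability.Percolation.BHK2006 (rcMass delW)
open Summit.CriticalPhenomena.PercolationContinuityZ3.Theorems.HullPort (cut avoidEv connS)
open scoped Classical

variable {V : Type*} [Fintype V]

/-- `c(ω) = Cov_{φ_{G − cut_X(ω), q}}(g(C_x), 1{v ↔ S})` (the memo's `H_W(v)`, `W = C_X(ω)`, for `φ_{𝐩,q}`).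
(transcription of prim-hp-7 HP7-HTW-PROOF.md §0 with FK worlds) [cite: VandenbergHaggstromKahn2005, §2.1 Lemma 2.3 (p. 10)] -/
def taCS (w : Sym2 V → unitInterval) (q : ℝ) (x : V) (S : Set V) (v : V) (X : Set V) (g : Set (Sym2 V) → ℝ)
    (ω : Set (Sym2 V)) : ℝ :=
  wE w q (cut X ω) (fun η => g (openEdgeCluster η x) * ind (connS S v) η) -
    wE w q (cut X ω) (fun η => g (openEdgeCluster η x)) * wE w q (cut X ω) (ind (connS S v))

/-- `φ_{G − cut_X(ω), q}(v ↮ S)` (the memo's `b_W`). [cite: VandenbergHaggstromKahn2005, §2.1 Lemma 2.3 (p. 10)] -/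
def taNS (w : Sym2 V → unitInterval) (q : ℝ) (S : Set V) (v : V) (X : Set V) (ω : Set (Sym2 V)) : ℝ :=
  wE w q (cut X ω) (ind (connS S v : Set (Set (Sym2 V)))ᶜ)

/-- `φ_{G − cut_X(ω), q}(v ↮ S, v ↔ o)` (the memo's `a_W`). [cite: VandenbergHaggstromKahn2005, §2.1 Lemma 2.3 (p. 10)] -/
def taNWS (w : Sym2 V → unitInterval) (q : ℝ) (S : Set V) (v o : V) (X : Set V) (ω : Set (Sym2 V)) : ℝ :=
  wE w q (cut X ω) (ind ((connS S v : Set (Set (Sym2 V)))ᶜ ∩ openConn v o))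

/-- `B = Σ_ω w_q(ω)·1{x ↮ X}·c(ω)` (unnormalised: `w_q = rcWeightW w q ∅`). (transcription of prim-hp-7 HP7-HTW-PROOF.md §1 for `φ_{𝐩,q}`)
[cite: Grimmett2006, §1.4 eq. (1.20) (p. 15)] -/
def taBS (w : Sym2 V → unitInterval) (q : ℝ) (x : V) (S : Set V) (v : V) (X : Set V) (g : Set (Sym2 V) → ℝ) : ℝ :=
  ∑ ω, rcWeightW w q ∅ ω * (ind (avoidEv x X) ω * taCS w q x S v X g ω)

/-- `A = Σ_ω w_q(ω)·1{x ↮ X}·(taNWS/taNS)(ω)·c(ω)` (unnormalised). (transcription of prim-hp-7 HP7-HTW-PROOF.md §1 for `φ_{𝐩,q}`)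
[cite: Grimmett2006, §1.4 eq. (1.20) (p. 15)] -/
def taAS (w : Sym2 V → unitInterval) (q : ℝ) (x : V) (S : Set V) (v o : V) (X : Set V) (g : Set (Sym2 V) → ℝ) : ℝ :=
  ∑ ω, rcWeightW w q ∅ ω * (ind (avoidEv x X) ω * (taNWS w q S v o X ω / taNS w q S v X ω * taCS w q x S v X g ω))

/-- `b = Z·φ(v ↮ S ∪ X)` (unnormalised). [cite: Grimmett2006, §1.4 eq. (1.20) (p. 15)] -/
def tabS (w : Sym2 V → unitInterval) (q : ℝ) (S : Set V) (v : V) (X : Set V) : ℝ :=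
  ∑ ω, rcWeightW w q ∅ ω * ind (avoidEv v (S ∪ X)) ω

/-- `a = Z·φ(v ↮ S ∪ X, v ↔ o)` (unnormalised). [cite: Grimmett2006, §1.4 eq. (1.20) (p. 15)] -/
def taaS (w : Sym2 V → unitInterval) (q : ℝ) (S : Set V) (v o : V) (X : Set V) : ℝ :=
  ∑ ω, rcWeightW w q ∅ ω * ind (avoidEv v (S ∪ X) ∩ openConn v o) ω

/-- `Q^S = A·b − a·B` (`= Z²·b·T^S` of HP7-HTW-PROOF (F1^S), for `φ_{𝐩,q}`). [cite: Grimmett2006, §1.4 eq. (1.20) (p. 15)] -/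
def taQS (w : Sym2 V → unitInterval) (q : ℝ) (x : V) (S : Set V) (v o : V) (X : Set V) (g : Set (Sym2 V) → ℝ) : ℝ :=
  taAS w q x S v o X g * tabS w q S v X - taaS w q S v o X * taBS w q x S v X g

end Summit.CriticalPhenomena.PercolationContinuityZ3.Theorems.FK

end
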